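import Summits.SmoothPoincare4.SmoothPoincare4.Theorems.SymplecticOrigamiGromovRecognitionRelEndStubReadSigmaAux2

/-!
# Reading the bi-foliation chart `σ` — flat leaves and the label functions at the wedge
(stub `stub_readSigma` of line `cross-cap-laurent`, crux `SymplecticOrigami.GromovRecognitionRelEnd`,
item stmt-SmoothPoincare4-11009; fourth auxiliary file)

* the area identity `dx₀∧dx₁ (A, α A + β I4 A) = β (A₀² + A₁²)` behind tameness (and its `z₂` twin);
* (B3) flat leaves: `σf (χ w) = (w₀, w₁, *, *)` for `|z₁| > R₁`, `= (*, *, w₂, w₃)` for `|z₂| > R₁`;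
* (B4)/(B5) the label functions `g = z₂ ∘ θV ∘ lamH ∘ ηV`, `h = z₁ ∘ θH ∘ lamV ∘ ηH` are smooth on
  the chart domains (`ηV '' D_V` misses `H∞`: wedge facts on the axis, `ι(M) ∩ H∞ = ∅` off it), read
  `σf` off the axes and are the identity on the axes.
-/

noncomputable section

-- the registered namespace `Summit.SmoothPoincare4.SmoothPoincare4.Theorems…` repeats a component
set_option linter.dupNamespace false

open scoped Manifold ContDiff Topology
open Set Function Filter Literature.Geometry.Symplectic

namespace Summit.SmoothPoincare4.SmoothPoincare4.Theorems.GromovRecognitionRelEnd.CrossCapLaurent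

namespace ReadSigma

open CapModel

/-- Model space `ℝ⁴ = ℂ²` (coordinates `0,1` = `z₁`, `2,3` = `z₂`). -/
local notation "E4" => EuclideanSpace ℝ (Fin 4)
/-- `ℝ² = ℂ`, the coordinate plane of one factor. -/
local notation "E2" => EuclideanSpace ℝ (Fin 2)

/-! ## The area identity behind tameness -/

/-- `dx₀∧dx₁ (A, α A + β I4 A) = β (A₀² + A₁²)`. [folklore] -/
theorem area01_of_hol (A A' : E4) (α β : ℝ) (hA' : A' = α • A + β • I4 A) :
    A 0 * A' 1 - A 1 * A' 0 = β * (A 0 ^ 2 + A 1 ^ 2) := by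
  subst hA'
  simp
  ring

/-- `dx₂∧dx₃ (B, α B + β I4 B) = β (B₂² + B₃²)`. [folklore] -/
theorem area23_of_hol (B B' : E4) (α β : ℝ) (hB' : B' = α • B + β • I4 B) :
    B 2 * B' 3 - B 3 * B' 2 = β * (B 2 ^ 2 + B 3 ^ 2) := by
  subst hB'
  simp
  ring

/-! ## Reading a coordinate of a smooth composite through `X` -/

/-- **The `z₂`-coordinate of a composite `G ∘ F : ℝ⁴ → X → ℝ⁴` of maps smooth along `s` is `C^∞` on
`s`.** [folklore] -/
theorem contDiffOn_T23_comp {X : Type*} [TopologicalSpace X] [ChartedSpace E4 X] {F : E4 → X}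
    {G : X → E4} {s : Set E4} (hF : ∀ p ∈ s, ContMDiffAt 𝓘(ℝ, E4) (𝓡 4) ∞ F p)
    (hG : ∀ p ∈ s, ContMDiffAt (𝓡 4) 𝓘(ℝ, E4) ∞ G (F p)) :
    ContDiffOn ℝ ∞ (fun p => T23 (G (F p))) s := by
  intro p hp
  have h3 : ContMDiffAt 𝓘(ℝ, E4) 𝓘(ℝ, E2) ∞ (fun p' => T23 (G (F p'))) p :=
    T23.contMDiff.contMDiffAt.comp p ((hG p hp).comp p (hF p hp))
  exact (contMDiffAt_iff_contDiffAt.1 h3).contDiffWithinAt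

/-- **The `z₁`-coordinate of a composite `G ∘ F : ℝ⁴ → X → ℝ⁴` of maps smooth along `s` is `C^∞` on
`s`.** [folklore] -/
theorem contDiffOn_T01_comp {X : Type*} [TopologicalSpace X] [ChartedSpace E4 X] {F : E4 → X}
    {G : X → E4} {s : Set E4} (hF : ∀ p ∈ s, ContMDiffAt 𝓘(ℝ, E4) (𝓡 4) ∞ F p)
    (hG : ∀ p ∈ s, ContMDiffAt (𝓡 4) 𝓘(ℝ, E4) ∞ G (F p)) :
    ContDiffOn ℝ ∞ (fun p => T01 (G (F p))) s := by
  intro p hp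
  have h3 : ContMDiffAt 𝓘(ℝ, E4) 𝓘(ℝ, E2) ∞ (fun p' => T01 (G (F p'))) p :=
    T01.contMDiff.contMDiffAt.comp p ((hG p hp).comp p (hF p hp))
  exact (contMDiffAt_iff_contDiffAt.1 h3).contDiffWithinAt

variable {M X : Type*} [TopologicalSpace M] [ChartedSpace E4 M] [IsManifold (𝓡 4) ∞ M]
  [TopologicalSpace X] [ChartedSpace E4 X] [IsManifold (𝓡 4) ∞ X]
  {J : AlmostComplexStructure (𝓡 4) ∞ M} {JX : AlmostComplexStructure (𝓡 4) ∞ X}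
  {ι : M → X} {ηH ηV ηC : E4 → X} {χ : E4 → M} {R₁ : ℝ} {lamV lamH : X → X}

namespace SigmaHyp

variable (h : SigmaHyp J JX ι ηH ηV ηC χ R₁ lamV lamH)
include h

/-! ## (B3): flat leaves read in the charts -/

/-- **(B3a)**: for `R₁² < |z₁|²`, `σf (χ w) = (w₀, w₁, *, *)`. [folklore] -/
theorem flat01 (w : E4) (hw : R₁ ^ 2 < w 0 ^ 2 + w 1 ^ 2) :
    (σf ι ηH ηV R₁ lamV lamH (χ w)) 0 = w 0 ∧ (σf ι ηH ηV R₁ lamV lamH (χ w)) 1 = w 1 := by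
  obtain ⟨c0, c1, -, -⟩ := σf_apply ι ηH ηV R₁ lamV lamH (χ w)
  have hp2 : (WithLp.toLp 2 ![w 0, w 1, 0, 0] : E4) 2 = 0 := by simp
  have hp3 : (WithLp.toLp 2 ![w 0, w 1, 0, 0] : E4) 3 = 0 := by simp
  rw [h.flat_V w hw, h.θH_ηH (h.mem_DH_of_axis hp2 hp3)] at c0 c1
  rw [c0, c1]
  simp

/-- **(B3b)**: for `R₁² < |z₂|²`, `σf (χ w) = (*, *, w₂, w₃)`. [folklore] -/
theorem flat23 (w : E4) (hw : R₁ ^ 2 < w 2 ^ 2 + w 3 ^ 2) :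
    (σf ι ηH ηV R₁ lamV lamH (χ w)) 2 = w 2 ∧ (σf ι ηH ηV R₁ lamV lamH (χ w)) 3 = w 3 := by
  obtain ⟨-, -, c2, c3⟩ := σf_apply ι ηH ηV R₁ lamV lamH (χ w)
  have hq0 : (WithLp.toLp 2 ![0, 0, w 2, w 3] : E4) 0 = 0 := by simp
  have hq1 : (WithLp.toLp 2 ![0, 0, w 2, w 3] : E4) 1 = 0 := by simp
  rw [h.flat_H w hw, h.θV_ηV (h.mem_DV_of_axis hq0 hq1)] at c2 c3
  rw [c2, c3]
  simp

/-! ## (B4), (B5): the label functions at the wedge -/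

/-- A point `ηV p`, `p ∈ D_V`, is off `H∞`: `lamH (ηV p) ≠ ηC 0` (wedge facts on the axis,
`ι(M) ∩ H∞ = ∅` off it). [folklore] -/
theorem lamH_ηV_ne {p : E4} (hp : p ∈ DV R₁) : lamH (ηV p) ≠ ηC 0 := by
  intro hc
  by_cases hax : p 0 = 0 ∧ p 1 = 0
  · rcases (h.lamH_corner _).1 hc with ⟨p', h2, h3, hp'⟩ | h0
    · exact h.wedge_HV p' p h2 h3 hax.1 hax.2 hp'
    · exact h.wedge_V p hax.1 hax.2 h0
  · have hr : ηV p ∈ range ι := by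
      rw [h.ηV_glue p hp (by tauto)]; exact mem_range_self _
    obtain ⟨x, hx⟩ := hr
    rw [← hx] at hc
    exact h.lamH_ι_ne x hc

/-- A point `ηH p`, `p ∈ D_H`, is off `V∞`: `lamV (ηH p) ≠ ηC 0`. [folklore] -/
theorem lamV_ηH_ne {p : E4} (hp : p ∈ DH R₁) : lamV (ηH p) ≠ ηC 0 := by
  intro hc
  by_cases hax : p 2 = 0 ∧ p 3 = 0
  · rcases (h.lamV_corner _).1 hc with ⟨q, h0, h1, hq⟩ | h0
    · exact h.wedge_HV p q hax.1 hax.2 h0 h1 hq.symm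
    · exact h.wedge_H p hax.1 hax.2 h0
  · have hr : ηH p ∈ range ι := by
      rw [h.ηH_glue p hp (by tauto)]; exact mem_range_self _
    obtain ⟨x, hx⟩ := hr
    rw [← hx] at hc
    exact h.lamV_ι_ne x hc

/-- **(B4) the `H`-label function `g = z₂ ∘ θV ∘ lamH ∘ ηV` is `C^∞` on `D_V`.** [folklore] -/
theorem contDiffOn_g : ContDiffOn ℝ ∞ (fun p => T23 (θV ηV R₁ (lamH (ηV p)))) (DV R₁) :=
  contDiffOn_T23_comp (G := fun y => θV ηV R₁ (lamH y)) (fun p hp => (h.ηV_locDiff ⟨p, hp⟩).contMDiffAt)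
    fun _ hp => h.contMDiffAt_θV_lamH (h.lamH_ηV_ne hp)

/-- **(B5) the `V`-label function `h = z₁ ∘ θH ∘ lamV ∘ ηH` is `C^∞` on `D_H`.** [folklore] -/
theorem contDiffOn_h : ContDiffOn ℝ ∞ (fun p => T01 (θH ηH R₁ (lamV (ηH p)))) (DH R₁) :=
  contDiffOn_T01_comp (G := fun y => θH ηH R₁ (lamV y)) (fun p hp => (h.ηH_locDiff ⟨p, hp⟩).contMDiffAt)
    fun _ hp => h.contMDiffAt_θH_lamV (h.lamV_ηH_ne hp)

/-- **(B4) off the axis `g` reads `σ`**: `g p = (σf (χ (1/u, z₂)))₂₃`. [folklore] -/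
theorem g_off_axis (p : E4) (hp : p 0 ^ 2 + p 1 ^ 2 < R₁⁻¹ ^ 2) (h0 : p 0 ≠ 0 ∨ p 1 ≠ 0) :
    T23 (θV ηV R₁ (lamH (ηV p))) = WithLp.toLp 2
      ![(σf ι ηH ηV R₁ lamV lamH (χ (WithLp.toLp 2
          ![p 0 / (p 0 ^ 2 + p 1 ^ 2), -(p 1) / (p 0 ^ 2 + p 1 ^ 2), p 2, p 3]))) 2,
        (σf ι ηH ηV R₁ lamV lamH (χ (WithLp.toLp 2
          ![p 0 / (p 0 ^ 2 + p 1 ^ 2), -(p 1) / (p 0 ^ 2 + p 1 ^ 2), p 2, p 3]))) 3] := by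
  obtain ⟨-, -, c2, c3⟩ := σf_apply ι ηH ηV R₁ lamV lamH
    (χ (WithLp.toLp 2 ![p 0 / (p 0 ^ 2 + p 1 ^ 2), -(p 1) / (p 0 ^ 2 + p 1 ^ 2), p 2, p 3]))
  rw [c2, c3, ← h.ηV_glue p hp h0, T23_apply]

/-- **(B4) on the axis `g` is the identity**: `g (0, z₂) = z₂`. [folklore] -/
theorem g_on_axis (p : E4) (h0 : p 0 = 0) (h1 : p 1 = 0) :
    T23 (θV ηV R₁ (lamH (ηV p))) = WithLp.toLp 2 ![p 2, p 3] := by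
  rw [h.lamH_axis p h0 h1, h.θV_ηV (h.mem_DV_of_axis h0 h1), T23_apply]

/-- **(B5) off the axis `h` reads `σ`**: `h p = (σf (χ (z₁, 1/t)))₀₁`. [folklore] -/
theorem h_off_axis (p : E4) (hp : p 2 ^ 2 + p 3 ^ 2 < R₁⁻¹ ^ 2) (h0 : p 2 ≠ 0 ∨ p 3 ≠ 0) :
    T01 (θH ηH R₁ (lamV (ηH p))) = WithLp.toLp 2
      ![(σf ι ηH ηV R₁ lamV lamH (χ (WithLp.toLp 2
          ![p 0, p 1, p 2 / (p 2 ^ 2 + p 3 ^ 2), -(p 3) / (p 2 ^ 2 + p 3 ^ 2)]))) 0,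
        (σf ι ηH ηV R₁ lamV lamH (χ (WithLp.toLp 2
          ![p 0, p 1, p 2 / (p 2 ^ 2 + p 3 ^ 2), -(p 3) / (p 2 ^ 2 + p 3 ^ 2)]))) 1] := by
  obtain ⟨c0, c1, -, -⟩ := σf_apply ι ηH ηV R₁ lamV lamH
    (χ (WithLp.toLp 2 ![p 0, p 1, p 2 / (p 2 ^ 2 + p 3 ^ 2), -(p 3) / (p 2 ^ 2 + p 3 ^ 2)]))
  rw [c0, c1, ← h.ηH_glue p hp h0, T01_apply]

/-- **(B5) on the axis `h` is the identity**: `h (z₁, 0) = z₁`. [folklore] -/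
theorem h_on_axis (p : E4) (h2 : p 2 = 0) (h3 : p 3 = 0) :
    T01 (θH ηH R₁ (lamV (ηH p))) = WithLp.toLp 2 ![p 0, p 1] := by
  rw [h.lamV_axis p h2 h3, h.θH_ηH (h.mem_DH_of_axis h2 h3), T01_apply]

end SigmaHyp

end ReadSigma

/-- **Registered helper sub-goal `helper_readSigmaAreaIdentity`** (fourth auxiliary file of stub
`stub_readSigma`): the area identity behind tameness — for `A ∈ ℝ⁴` and `A' = α A + β (i ⊕ i) A`,
`dx₀∧dx₁ (A, A') = β (A₀² + A₁²)`. [folklore] -/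
theorem helper_readSigmaAreaIdentity : ∀ (A : EuclideanSpace ℝ (Fin 4)) (α β : ℝ),
    A 0 * (α • A + β • WithLp.toLp 2 ![-(A 1), A 0, -(A 3), A 2]) 1 -
      A 1 * (α • A + β • WithLp.toLp 2 ![-(A 1), A 0, -(A 3), A 2]) 0 =
    β * (A 0 ^ 2 + A 1 ^ 2) :=
  fun A α β => ReadSigma.area01_of_hol A _ α β rfl

/-- **Registered helper sub-goal `helper_readSigmaLabelSmooth`** (fourth auxiliary file of stub
`stub_readSigma`): the `z₂`-coordinate of a composite `G ∘ F : ℝ⁴ → X → ℝ⁴` with `F` smooth at the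
points of `s` and `G` smooth at their images is `C^∞` on `s` (the shape of the label functions
`g`, `h` of (B4), (B5)). [folklore] -/
theorem helper_readSigmaLabelSmooth : ∀ (X : Type) [TopologicalSpace X]
    [ChartedSpace (EuclideanSpace ℝ (Fin 4)) X] (F : EuclideanSpace ℝ (Fin 4) → X)
    (G : X → EuclideanSpace ℝ (Fin 4)) (s : Set (EuclideanSpace ℝ (Fin 4))),
    (∀ p ∈ s, ContMDiffAt 𝓘(ℝ, EuclideanSpace ℝ (Fin 4)) (𝓡 4) ∞ F p) →
    (∀ p ∈ s, ContMDiffAt (𝓡 4) 𝓘(ℝ, EuclideanSpace ℝ (Fin 4)) ∞ G (F p)) →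
    ContDiffOn ℝ ∞ (fun p => (WithLp.toLp 2 ![(G (F p)) 2, (G (F p)) 3] :
      EuclideanSpace ℝ (Fin 2))) s :=
  fun _ _ _ _ _ _ hF hG => ReadSigma.contDiffOn_T23_comp hF hG

end Summit.SmoothPoincare4.SmoothPoincare4.Theorems.GromovRecognitionRelEnd.CrossCapLaurent

end
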